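import Mathlib
import Summits.ValiantsHypothesis.ValiantsHypothesis.Theorems.GeneratorObstructionsPowGenDegreeQPGadgetTableauClasses
import Summits.ValiantsHypothesis.ValiantsHypothesis.Theorems.GeneratorObstructionsPowGenDegreeQPPermFibersPi

/-!
# Route GeneratorObstructions — crux K2 `PowGenDegreeQP` (stmt-ValiantsHypothesis-11655), line
# `trace-side-regimes`: the gadget count as a sum over fibrewise (block-respecting) rearrangements

Step (R1) of the factorisation half of the last certificate theorem `gadgetTab_count` (skeleton on the
item): by type preservation (`gadgetTab_block_eq`) the indicator "every label receives SOME gadget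
monomial" equals "every label receives the monomial of ITS block" (`valid_iff_ownBlock`); such
rearrangements preserve the block of every row (`blockOfRow_perm_eq`), so by
`sum_sign_ite_classPreservingPi` the signed count is a sum over tuples
`ρ : Π n, Π j : Fin c, Perm {r // rowBlock n r = j}` of per-(column, block) permutations with the sign
`∏_n ∏_j sign (ρ n j)` (`gadgetTab_count_eq_fiberSum`).  What then remains (R2–R3) is to transport
each fibre to `Fin 3` / `Fin 2` (D* blocks, `blockExpo = blockTgt`) and regroup over (block, copy).

Honest framing: combinatorics of one explicit tableau; no stub, crux or summit is settled here;
`VP ≠ VNP` untouched. [folklore]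
-/

namespace Summit.ValiantsHypothesis.ValiantsHypothesis.Theorems.GeneratorObstructions.PowGenDegreeQP

open Literature.Computability.AlgebraicComplexity Literature.Computability.AlgebraicComplexity.TableauEval

-- `Summit.ValiantsHypothesis.ValiantsHypothesis.…` is the tree's mandated single-conjunct layout.
set_option linter.dupNamespace false

noncomputable section

variable {σ : Type*} [LinearOrder σ]

/-- The block (as an element of `Fin c`) of row `r` of column `n` of the gadget tableau. [folklore] -/
def rowBlock (k c : ℕ) (hk : 1 ≤ k) (hc : 1 ≤ c) (x : ℕ → σ) (n : Fin (gadgetTab k c hk hc x).C)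
    (r : Fin ((gadgetTab k c hk hc x).h n)) : Fin c :=
  ⟨blockOfRow c r.val, (letterRow_blockOfRow_kindOfRow hc
    (lt_of_lt_of_le r.isLt (colHeight_le k c n))).1⟩

/-- **Valid ⟺ valid with own blocks** (type preservation, `gadgetTab_block_eq`). [folklore] -/
theorem valid_iff_ownBlock (k c : ℕ) (hk : 1 ≤ k) (hc : 1 ≤ c) {x : ℕ → σ} {N : ℕ}
    (hx : IsAntitoneEnum x N) (hN : 3 * c ≤ N) (π : (gadgetTab k c hk hc x).Bij) :
    (∀ u, ∃ j : Fin c, (gadgetTab k c hk hc x).content π u =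
        gadgetExp k (fun i : Fin c => x (letterRow c i 2)) (fun i => x (letterRow c i 1))
          (fun i => x (letterRow c i 0)) j) ↔
      (∀ u : Fin (gadgetTab k c hk hc x).d, (gadgetTab k c hk hc x).content π u =
        gadgetExp k (fun i : Fin c => x (letterRow c i 2)) (fun i => x (letterRow c i 1))
          (fun i => x (letterRow c i 0)) ⟨labBlock u, (labBlock_lt u).1⟩) := by
  constructor
  · intro h
    choose J hJ using h
    have hb := gadgetTab_block_eq k c hk hc hx hN π J hJ
    intro u
    rw [hJ u]
    congr 1
    exact Fin.ext (hb u)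
  · intro h u
    exact ⟨_, h u⟩

/-- **(R1) The gadget count as a sum over fibrewise rearrangements.** [folklore] -/
theorem gadgetTab_count_eq_fiberSum (k c : ℕ) (hk : 1 ≤ k) (hc : 1 ≤ c) {x : ℕ → σ} {N : ℕ}
    (hx : IsAntitoneEnum x N) (hN : 3 * c ≤ N) :
    (∑ π : (gadgetTab k c hk hc x).Bij, (((gadgetTab k c hk hc x).sgnProd π : ℤ) : ℂ) *
      (if ∀ u, ∃ j : Fin c, (gadgetTab k c hk hc x).content π u =
          gadgetExp k (fun j : Fin c => x (letterRow c j 2)) (fun j => x (letterRow c j 1))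
            (fun j => x (letterRow c j 0)) j then 1 else 0)) =
      ∑ ρ : (n : Fin (gadgetTab k c hk hc x).C) → (j : Fin c) →
          Equiv.Perm {r : Fin ((gadgetTab k c hk hc x).h n) // rowBlock k c hk hc x n r = j},
        (∏ n, ∏ j, ((Equiv.Perm.sign (ρ n j) : ℤ) : ℂ)) *
          (if ∀ u : Fin (gadgetTab k c hk hc x).d,
              (gadgetTab k c hk hc x).content (fiberPermPi (rowBlock k c hk hc x) ρ) u =
                gadgetExp k (fun i : Fin c => x (letterRow c i 2)) (fun i => x (letterRow c i 1))
                  (fun i => x (letterRow c i 0)) ⟨labBlock u, (labBlock_lt u).1⟩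
            then 1 else 0) := by
  classical
  have key := sum_sign_ite_classPreservingPi (rowBlock k c hk hc x) (R := ℂ)
    (fun π => if ∀ u : Fin (gadgetTab k c hk hc x).d,
        (gadgetTab k c hk hc x).content π u =
          gadgetExp k (fun i : Fin c => x (letterRow c i 2)) (fun i => x (letterRow c i 1))
            (fun i => x (letterRow c i 0)) ⟨labBlock u, (labBlock_lt u).1⟩ then (1 : ℂ) else 0)
  refine Eq.trans ?_ key
  refine Finset.sum_congr rfl fun π _ => ?_
  -- the sign product
  have hsgn : (((gadgetTab k c hk hc x).sgnProd π : ℤ) : ℂ) =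
      ∏ n, ((Equiv.Perm.sign (π n) : ℤ) : ℂ) := by
    rw [TabM.sgnProd, Units.coe_prod, Int.cast_prod]
  rw [hsgn]
  by_cases hV : ∀ u : Fin (gadgetTab k c hk hc x).d, (gadgetTab k c hk hc x).content π u =
      gadgetExp k (fun i : Fin c => x (letterRow c i 2)) (fun i => x (letterRow c i 1))
        (fun i => x (letterRow c i 0)) ⟨labBlock u, (labBlock_lt u).1⟩
  · -- valid: class-preserving, both indicators are `1`
    have hcp : ∀ n a, rowBlock k c hk hc x n (π n a) = rowBlock k c hk hc x n a := fun n a =>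
      Fin.ext (blockOfRow_perm_eq k c hk hc hx hN π hV n a)
    rw [if_pos hcp, if_pos hV, if_pos ((valid_iff_ownBlock k c hk hc hx hN π).mpr hV)]
  · rw [if_neg (fun h => hV ((valid_iff_ownBlock k c hk hc hx hN π).mp h)), if_neg hV]
    split_ifs <;> simp

end

end Summit.ValiantsHypothesis.ValiantsHypothesis.Theorems.GeneratorObstructions.PowGenDegreeQP
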